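import Literature.AlgebraicGeometry.GroupSchemes.IdealKernelLayerIsoOfSerreCover            -- ★ (R8) ED. 2 `exists_layerIso_of_serreCover_of_iso`
import Literature.AlgebraicGeometry.AbelianSchemes.SerreTranslateCoverLeg                    -- ★ cover-leg laws at an iterated base change
import Literature.AlgebraicGeometry.AbelianSchemes.SerreTensorIntegralIdealCoverKernel        -- ★ α2a′ kernel law of `ψ′_Q`, α2a return maps
import Literature.AlgebraicGeometry.AbelianSchemes.SerreTensorIdealTranslationQuasiInverse   -- ★ `i_comp_serreTranslateInv`
import Mathlib.RingTheory.DedekindDomain.Ideal.Lemmas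
import HarnessLib

/-!
# The `𝔭`-layers of two fibres of `𝒜` joined by a REDUCED RECOGNITION `(𝒜 ⊗_𝒪 𝔟)_{s₁} ≅ 𝒜_{s₂}` are isomorphic, equivariantly
# (any field, any characteristic; [Conrad 2004] §7 Thm. 7.5, [Mumford 1970] §7 Thm. 4, [Tate 1997] (3.7))

Topic `Literature/AlgebraicGeometry/AbelianSchemes`; namespace `Literature.AlgebraicGeometry.AbelianSchemes.AbelianSchemeOver`.  THEOREMS ONLY (no definition, no named
fact, no `instance`, no notation, no `sorry`).  Cell `hodgecm-mathlib` (D-0151), FLOOR 0, P6 «MOD programme» (crux hLiu418 = stmt-HodgeConjecture-24832, `--supports`,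
count-neutral): organ **(R9) «LAYER ISO FROM A REDUCED RECOGNITION»** of line L2 (socket `stub_DOWN`, organ `stub_LAYERISO`, recognition road: A-p03 (g31) 02:35:26Z,
LA2-plan (g0) 02:41:38Z; the downstairs half after LA3-p02՚s `exists_reducedRecognition` (ι)-law): over a base `Y` an abelian scheme `𝒜` with an `𝒪`-action (`𝒪` Dedekind) and
a Serre presentation `(E, P, Q, N)` of a nonzero ideal (★ `exists_serrePresentation_of_ideal`), two field points `s₁, s₂` of an intermediate base `Y′ → Y`, an EQUIVARIANT
ISOMORPHISM `u : (𝒜 ⊗ 𝔟)_{s₁} ⥲ 𝒜_{s₂}` of the iterated-base-change fibres (the reduced recognition, ★ (ν8d)), and PINS of the `𝔭`-layers of `𝒜_{s₁}`, `𝒜_{s₂}` of equal rank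
(the two docks): THEN `𝒜_{s₁}[𝔭] ≅ 𝒜_{s₂}[𝔭]` as group schemes, equivariantly for the actions on the pins.  HC_CM is proved only modulo the printed citations (2 remaining
named inputs hLiu418 24832, h413 24833) until rung 0 closes; this file is generic and changes no count.

THE MATHEMATICS.  The family cover `ψ′_Q : 𝒜 ⊗ 𝔟 → 𝒜` (★ `serreTranslateInv`) is finite, flat, surjective, `𝒪`-equivariant, with kernel EXACTLY the `𝔞′`-torsion for
`𝔞′ = (Q₁, …, Q_m)` on all `T`-points at every base (★ α2a′ + ★ `idealKernelLaw_baseChangeHom`), and for every generator `c` of `𝔞′` the return map `ψ_{P_c}` has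
`ψ′_Q ≫ ψ_{P_c} = ι(c)` (★ α2a).  The generators of `𝔞′` do not all lie in `𝔞′𝔭` (`𝔞′𝔭 < 𝔞′`, Dedekind), so some `c₀` has `(c₀) = 𝔞′𝔠` with `𝔠 ⊄ 𝔭`, whence a cofactor
`r ∈ 𝔠 ∖ 𝔭`: `r𝔞′ ⊆ (c₀)`, `r r′ ≡ 1 (mod 𝔭)`.  ★ (R8) `exists_layerIso_of_serreCover_of_iso` at the fibre `s₁` with the source pinned through `u` gives the layer iso.

* §1 `Ideal.exists_generator_cofactor` — the generator of exact valuation and its cofactor (pure ideal arithmetic);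
* §2 **`exists_layerIso_of_reducedRecognition`** — THE HEAD; (ED. 2) `exists_layerIso_of_reducedRecognition_pkg` — the same with the presentation + recognition as ONE ∃-package; (ED. 3) `exists_layerIso_of_reducedRecognition_of_rank` — ranks read BEFORE the group structures (dock shape), `Module.Finite` derived.
* §3 (ED. 4) **`exists_layerIso_of_fibreRecognition`**, `exists_layerIso_of_fibreRecognition_of_rank` — THE FIBRE-LEVEL FORM: two abelian schemes `A₁, A₂` over ONE field with actions, an equivariant isomorphism `u : A₁ ⊗_𝒪 𝔟 ⥲ A₂` of the Serre tensor OF `A₁` (the shape ★ KER-EQ `exists_iso_serreTranslate_comp_eq_equivariant_of_comp_eq_one_iff_forall_mem` delivers from a reduced cover with kernel `A₁[𝔞]`; no model-level Serre family, no base change), pins of the `𝔭`-layers ⇒ `A₁[𝔭] ≅ A₂[𝔭]` equivariantly.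

## References
* [Conrad2004GrossZagier] B. Conrad, *Gross–Zagier revisited*, MSRI Publ. 49 (2004), §7 (Thm. 7.5).
* [MumfordAV1970] D. Mumford, *Abelian Varieties* (1970), §7 Thm. 4 (p. 72).
* [Tate1997FiniteFlatGroupSchemes] J. Tate, *Finite flat group schemes* (1997), (3.7).
-/

set_option autoImplicit false

set_option backward.isDefEq.respectTransparency false

noncomputable section

universe u

open CategoryTheory CategoryTheory.Limits AlgebraicGeometry MonoidalCategory CartesianMonoidalCategory
open scoped MonObj

/-! ## §1 The generator of exact valuation and its cofactor -/

/-- **A generator outside `𝔞𝔭` and its cofactor**: for a generating set `G` of a nonzero ideal `𝔞` of a Dedekind domain and a maximal ideal `𝔭` there are `c₀ ∈ G` and `r, r′`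
with `r𝔞 ⊆ (c₀)` and `r r′ = 1 + q`, `q ∈ 𝔭` — the generators cannot all lie in `𝔞𝔭 < 𝔞`; `(c₀) = 𝔞𝔠` with `𝔠 ⊄ 𝔭`; take `r ∈ 𝔠 ∖ 𝔭` and `𝔭 + (r) = 𝒪`.
[cite: Conrad2004GrossZagier, §7 (Thm. 7.5)] -/
theorem _root_.Ideal.exists_generator_cofactor {R : Type*} [CommRing R] [IsDedekindDomain R] (G : Set R) (hG : Ideal.span G ≠ ⊥)
    (𝔭 : Ideal R) [𝔭.IsMaximal] :
    ∃ c₀ ∈ G, ∃ r r' : R, (∀ a' ∈ Ideal.span G, ∃ x : R, a' * r = x * c₀) ∧ ∃ q ∈ 𝔭, r * r' = 1 + q := by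
  have hlt : Ideal.span G * 𝔭 < Ideal.span G := by
    refine lt_of_le_of_ne Ideal.mul_le_right fun h => ?_
    have h' : Ideal.span G * 𝔭 = Ideal.span G * 1 := by rw [mul_one]; exact h
    exact Ideal.IsMaximal.ne_top ‹_› ((mul_left_cancel₀ hG h').trans Ideal.one_eq_top)
  have hnot : ¬ G ⊆ (Ideal.span G * 𝔭 : Ideal R) := fun hsub =>
    (ne_of_lt hlt) (le_antisymm Ideal.mul_le_right (Ideal.span_le.mpr hsub))
  obtain ⟨c₀, hc₀G, hc₀⟩ := Set.not_subset.mp hnot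
  have hc₀𝔞 : c₀ ∈ Ideal.span G := Ideal.subset_span hc₀G
  obtain ⟨𝔠, h𝔠⟩ : Ideal.span G ∣ Ideal.span {c₀} := Ideal.dvd_span_singleton.mpr hc₀𝔞
  have hnc : ¬ 𝔠 ≤ 𝔭 := fun hle => hc₀ (by
    have : Ideal.span {c₀} ≤ Ideal.span G * 𝔭 := h𝔠 ▸ Ideal.mul_mono_right hle
    exact this (Ideal.mem_span_singleton_self c₀))
  obtain ⟨b, hb, hb'⟩ := Set.not_subset.mp hnc
  have htop : 𝔭 ⊔ Ideal.span {b} = ⊤ := by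
    by_contra h
    have h' : 𝔭 = 𝔭 ⊔ Ideal.span {b} := Ideal.IsMaximal.eq_of_le ‹_› h le_sup_left
    exact hb' (h'.symm ▸ Ideal.mem_sup_right (Ideal.mem_span_singleton_self b))
  obtain ⟨q, hq, z, hz, hqz⟩ := Submodule.mem_sup.mp ((htop.symm ▸ Submodule.mem_top : (1 : R) ∈ 𝔭 ⊔ Ideal.span {b}))
  obtain ⟨y', hy'⟩ := Ideal.mem_span_singleton'.mp hz
  refine ⟨c₀, hc₀G, b, y', fun a' ha' => ?_, ⟨-q, neg_mem hq, ?_⟩⟩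
  · have hmem : a' * b ∈ Ideal.span {c₀} := by
      rw [h𝔠]
      exact Ideal.mul_mem_mul ha' hb
    obtain ⟨x, hx⟩ := Ideal.mem_span_singleton'.mp hmem
    exact ⟨x, hx.symm⟩
  · rw [mul_comm b y', hy', ← hqz]
    ring

namespace Literature.AlgebraicGeometry.AbelianSchemes

namespace AbelianSchemeOver

open Literature.AlgebraicGeometry.Motives (SchemeOver specOver)
open Literature.AlgebraicGeometry.GroupSchemes.IdealKernelLayerIso
open Literature.AlgebraicGeometry.GroupSchemes.AffineGroupScheme (Alg)

/-! ## §2 The layer isomorphism from a reduced recognition -/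

variable {Y Y' : Scheme.{u}} (g : Y' ⟶ Y) {k : Type u} [Field k] (s₁ s₂ : Spec (.of k) ⟶ Y')
  {A : AbelianSchemeOver Y} {O : Type*} [CommRing O] [IsDedekindDomain O] [CharZero O] (act : A.RingAction O) [IsCommMonObj A.X]
  {m : ℕ} (E : Matrix (Fin m) (Fin m) O) (hE : E * E = E) (P : Matrix (Fin m) (Fin 1) O) (Q : Matrix (Fin 1) (Fin m) O) {N : ℕ}

set_option maxHeartbeats 400000 in
/-- **LAYER ISO FROM A REDUCED RECOGNITION (one `obtain`).**  `𝒜∕Y` an abelian scheme with an action of a Dedekind domain `𝒪`, `(E, P, Q, N)` a Serre presentation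
(`EP = P`, `QE = Q`, `QP = N ≠ 0`, `PQ = N•E`, the entries of `Q` in the range of its first row, and a column `P_c` for every such entry: ★ `exists_serrePresentation_of_ideal`),
`𝔭` a maximal ideal, `s₁, s₂ : Spec k → Y′ → Y` two field points, `u : ((𝒜 ⊗ 𝔟) ×_Y Y′) ×_{Y′} s₁ ⥲ (𝒜 ×_Y Y′) ×_{Y′} s₂` an ISOMORPHISM of `k`-group schemes intertwining the
Serre action and the action (the reduced recognition), and PINS `ι₁`, `ι₂` of the `𝔭`-layers of the two fibres of `𝒜` (homomorphic closed immersions with the kernel-of-`𝔭`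
universal property, affine, finite, coordinate algebras finite of EQUAL rank, with actions `β₁`, `β₂` over the fibre actions).  THEN `∃ φ : G₁ ≅ G₂`, a homomorphism both ways,
with `β₁ x ≫ φ.hom = φ.hom ≫ β₂ x` and `β₂ x ≫ φ.inv = φ.inv ≫ β₁ x`.
[cite: Conrad2004GrossZagier, §7 (Thm. 7.5)] [cite: MumfordAV1970, §7 Thm. 4 (p. 72)] [cite: Tate1997FiniteFlatGroupSchemes, (3.7)] -/
theorem exists_layerIso_of_reducedRecognition
    (hN : N ≠ 0) (hP : E * P = P) (hQ : Q * E = Q)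
    (hQP : Q * P = Matrix.scalar (Fin 1) (N : O)) (hPQ : P * Q = Matrix.scalar (Fin m) (N : O) * E)
    (hQr : ∀ j k', Q j k' ∈ Set.range fun k' => Q 0 k')
    (hPc : ∀ c ∈ Set.range (fun k' => Q 0 k'), ∃ Pc : Matrix (Fin m) (Fin 1) O, E * Pc = Pc ∧ Pc * Q = c • E)
    (𝔭 : Ideal O) [𝔭.IsMaximal]
    (u : (((serreTensor act E hE).baseChange g).baseChange s₁).X ⟶ ((A.baseChange g).baseChange s₂).X) [IsMonHom u] [IsIso u]
    (hu : ∀ a, (((serreAction act E hE).baseChange g).baseChange s₁).i a ≫ u = u ≫ ((act.baseChange g).baseChange s₂).i a)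
    {G₁ G₂ : SchemeOver k} [GrpObj G₁] [GrpObj G₂] [IsAffine G₁.left] [IsAffine G₂.left]
    [Module.Finite k (Alg G₁)] [Module.Finite k (Alg G₂)] [IsFinite G₁.hom] [IsFinite G₂.hom]
    (ι₁ : G₁ ⟶ ((A.baseChange g).baseChange s₁).X) (hι₁ : IsMonHom ι₁ ∧ IsClosedImmersion ι₁.left)
    (hker₁ : ∀ ⦃T : SchemeOver k⦄ (t : T ⟶ ((A.baseChange g).baseChange s₁).X),
      (∀ x ∈ 𝔭, t ≫ ((act.baseChange g).baseChange s₁).i x = 1) ↔ ∃ s' : T ⟶ G₁, s' ≫ ι₁ = t)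
    (β₁ : O → (G₁ ⟶ G₁)) (hβ₁ : ∀ x, β₁ x ≫ ι₁ = ι₁ ≫ ((act.baseChange g).baseChange s₁).i x)
    (ι₂ : G₂ ⟶ ((A.baseChange g).baseChange s₂).X) (hι₂ : IsMonHom ι₂ ∧ IsClosedImmersion ι₂.left)
    (hker₂ : ∀ ⦃T : SchemeOver k⦄ (t : T ⟶ ((A.baseChange g).baseChange s₂).X),
      (∀ x ∈ 𝔭, t ≫ ((act.baseChange g).baseChange s₂).i x = 1) ↔ ∃ s' : T ⟶ G₂, s' ≫ ι₂ = t)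
    (β₂ : O → (G₂ ⟶ G₂)) (hβ₂ : ∀ x, β₂ x ≫ ι₂ = ι₂ ≫ ((act.baseChange g).baseChange s₂).i x)
    (hrank : Module.finrank k (Alg G₁) = Module.finrank k (Alg G₂)) :
    ∃ φ : G₁ ≅ G₂, IsMonHom φ.hom ∧ IsMonHom φ.inv ∧ (∀ x, β₁ x ≫ φ.hom = φ.hom ≫ β₂ x) ∧ (∀ x, β₂ x ≫ φ.inv = φ.inv ≫ β₁ x) := by
  -- (1) the generator `c₀` of `𝔞′ = (Q)` outside `𝔞′𝔭` and its cofactor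
  have hspanQ : Ideal.span (Set.range fun k' => Q 0 k') ≠ ⊥ := by
    intro h0
    have hQ0 : ∀ k', Q 0 k' = 0 := fun k' => by
      have : Q 0 k' ∈ Ideal.span (Set.range fun k' => Q 0 k') := Ideal.subset_span ⟨k', rfl⟩
      rw [h0] at this
      exact (Submodule.mem_bot _).mp this
    have hQP0 : (Q * P) 0 0 = 0 := by
      rw [Matrix.mul_apply]
      exact Finset.sum_eq_zero fun k' _ => by rw [hQ0 k', zero_mul]
    rw [hQP, Matrix.scalar_apply, Matrix.diagonal_apply_eq] at hQP0
    exact hN (Nat.cast_eq_zero.mp hQP0)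
  obtain ⟨c₀, hc₀, r, r', hr, hrr'⟩ := Ideal.exists_generator_cofactor (Set.range fun k' => Q 0 k') hspanQ 𝔭
  obtain ⟨Pc, hPc1, hPc2⟩ := hPc c₀ hc₀
  -- (2) the family cover `ψ := ψ′_Q` and the return map `ψ′ := ψ_{Pc}` at the fibre `s₁`
  haveI : IsMonHom (baseChangeHom (baseChangeHom (serreTranslateInv act E hE Q) g) s₁) := by
    haveI := isMonHom_serreTranslateInv act E hE Q
    haveI := isMonHom_baseChangeHom (serreTranslateInv act E hE Q) g
    exact isMonHom_baseChangeHom _ _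
  haveI : IsMonHom (baseChangeHom (baseChangeHom (serreTranslate act E hE Pc) g) s₁) := isMonHom_coverLeg g s₁ act E hE Pc
  haveI : Flat (baseChangeHom (baseChangeHom (serreTranslateInv act E hE Q) g) s₁).left := by
    haveI := flat_serreTranslateInv_left act E hE Q P hN hP hQ hQP hPQ
    haveI := flat_baseChangeHom_left g (serreTranslateInv act E hE Q)
    exact flat_baseChangeHom_left _ _
  haveI : Surjective (baseChangeHom (baseChangeHom (serreTranslateInv act E hE Q) g) s₁).left := by
    haveI := surjective_serreTranslateInv_left act E hE Q P hN hP hQ hQP hPQ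
    haveI := surjective_baseChangeHom_left g (serreTranslateInv act E hE Q)
    exact surjective_baseChangeHom_left _ _
  haveI : IsFinite (baseChangeHom (baseChangeHom (serreTranslateInv act E hE Q) g) s₁).left := by
    haveI := isFinite_serreTranslateInv_left act E hE Q P hN hP hQ hQP hPQ
    haveI := isFinite_baseChangeHom_left g (serreTranslateInv act E hE Q)
    exact isFinite_baseChangeHom_left _ _
  have hψeq : ∀ a : O,
      (((serreAction act E hE).baseChange g).baseChange s₁).i a ≫ baseChangeHom (baseChangeHom (serreTranslateInv act E hE Q) g) s₁ =
        baseChangeHom (baseChangeHom (serreTranslateInv act E hE Q) g) s₁ ≫ ((act.baseChange g).baseChange s₁).i a := fun a =>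
    i_baseChange_comp_baseChangeHom s₁ _ _ _ a (i_baseChange_comp_baseChangeHom g _ _ _ a (i_comp_serreTranslateInv act E hE Q hQ a))
  have hψ'eq : ∀ a : O,
      ((act.baseChange g).baseChange s₁).i a ≫ baseChangeHom (baseChangeHom (serreTranslate act E hE Pc) g) s₁ =
        baseChangeHom (baseChangeHom (serreTranslate act E hE Pc) g) s₁ ≫ (((serreAction act E hE).baseChange g).baseChange s₁).i a := fun a =>
    i_comp_coverLeg g s₁ act E hE Pc hPc1 a
  have hψψ' : baseChangeHom (baseChangeHom (serreTranslateInv act E hE Q) g) s₁ ≫ baseChangeHom (baseChangeHom (serreTranslate act E hE Pc) g) s₁ =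
      (((serreAction act E hE).baseChange g).baseChange s₁).i c₀ := by
    rw [RingAction.baseChange_i, RingAction.baseChange_i]
    change (Over.pullback s₁).map ((Over.pullback g).map _) ≫ (Over.pullback s₁).map ((Over.pullback g).map _) = _
    rw [← Functor.map_comp, ← Functor.map_comp, serreTranslateInv_comp_serreTranslate_of_mul_eq_smul act E hE Q hQ Pc hPc1 hPc2]
  have hkerψ : ∀ ⦃T : SchemeOver k⦄ (t : T ⟶ (((serreTensor act E hE).baseChange g).baseChange s₁).X),
      (∀ a' ∈ Ideal.span (Set.range fun k' => Q 0 k'), t ≫ (((serreAction act E hE).baseChange g).baseChange s₁).i a' = 1) →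
        t ≫ baseChangeHom (baseChangeHom (serreTranslateInv act E hE Q) g) s₁ = 1 := by
    intro T t ht
    have key := idealKernelLaw_baseChangeHom s₁ ((serreAction act E hE).baseChange g) (baseChangeHom (serreTranslateInv act E hE Q) g)
      (Set.range fun k' => Q 0 k')
      (idealKernelLaw_baseChangeHom g (serreAction act E hE) (serreTranslateInv act E hE Q) (Set.range fun k' => Q 0 k')
        (fun _ t₀ => comp_serreTranslateInv_eq_one_iff_forall_comp_serreAction_i_eq_one act E hE Q hQ _ hQr hPc t₀)) t
    exact key.mpr fun a' ha' => ht a' (Ideal.subset_span ha')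
  -- (3) ★ (R8) ED. 2 at the fibre `s₁`, source pinned through `u`
  obtain ⟨φ, -, hmon, hmon', hβ, hβ'⟩ :=
    exists_layerIso_of_serreCover_of_iso (k := k) 𝔭 (Ideal.span (Set.range fun k' => Q 0 k'))
      (fun a => (((serreAction act E hE).baseChange g).baseChange s₁).i a)
      (fun a => ((act.baseChange g).baseChange s₁).i a)
      (fun a => ((act.baseChange g).baseChange s₂).i a)
      (fun a => RingAction.isMonHom _ a) (fun a => RingAction.isMonHom _ a)
      (fun a b => RingAction.i_mul _ a b)
      (fun a b => RingAction.i_mul _ a b) (fun a b => RingAction.i_add _ a b) (RingAction.i_one _)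
      u hu ι₂ hι₂ hker₂ β₂ hβ₂ ι₁ hι₁ hker₁ β₁ hβ₁ hrank
      (baseChangeHom (baseChangeHom (serreTranslateInv act E hE Q) g) s₁) hψeq hkerψ hr hrr'
      (baseChangeHom (baseChangeHom (serreTranslate act E hE Pc) g) s₁) hψ'eq hψψ'
  exact ⟨φ, hmon, hmon', hβ, hβ'⟩

set_option maxHeartbeats 400000 in
/-- **PACKAGED FORM (ED. 2)** — the same with the presentation AND the reduced recognition delivered as ONE existential package `pkg` (the shape in which the L2 leaf՚s
upstairs chain hands them over; destructuring the package inside the moduli tower exceeds the heartbeat budget, so it is opened HERE, over the abstract base).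
[cite: Conrad2004GrossZagier, §7 (Thm. 7.5)] [cite: MumfordAV1970, §7 Thm. 4 (p. 72)] [cite: Tate1997FiniteFlatGroupSchemes, (3.7)] -/
theorem exists_layerIso_of_reducedRecognition_pkg (𝔭 : Ideal O) [𝔭.IsMaximal]
    (pkg : ∃ (m : ℕ) (E : Matrix (Fin m) (Fin m) O) (hE : E * E = E) (P : Matrix (Fin m) (Fin 1) O) (Q : Matrix (Fin 1) (Fin m) O) (N : ℕ),
        N ≠ 0 ∧ E * P = P ∧ Q * E = Q ∧ Q * P = Matrix.scalar (Fin 1) (N : O) ∧ P * Q = Matrix.scalar (Fin m) (N : O) * E ∧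
        (∀ j k', Q j k' ∈ Set.range fun k' => Q 0 k') ∧
        (∀ c ∈ Set.range (fun k' => Q 0 k'), ∃ Pc : Matrix (Fin m) (Fin 1) O, E * Pc = Pc ∧ Pc * Q = c • E) ∧
        ∃ (u : (((serreTensor act E hE).baseChange g).baseChange s₁).X ⟶ ((A.baseChange g).baseChange s₂).X) (_ : IsMonHom u) (_ : IsIso u),
          ∀ a, (((serreAction act E hE).baseChange g).baseChange s₁).i a ≫ u = u ≫ ((act.baseChange g).baseChange s₂).i a)
    {G₁ G₂ : SchemeOver k} [GrpObj G₁] [GrpObj G₂] [IsAffine G₁.left] [IsAffine G₂.left]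
    [Module.Finite k (Alg G₁)] [Module.Finite k (Alg G₂)] [IsFinite G₁.hom] [IsFinite G₂.hom]
    (ι₁ : G₁ ⟶ ((A.baseChange g).baseChange s₁).X) (hι₁ : IsMonHom ι₁ ∧ IsClosedImmersion ι₁.left)
    (hker₁ : ∀ ⦃T : SchemeOver k⦄ (t : T ⟶ ((A.baseChange g).baseChange s₁).X),
      (∀ x ∈ 𝔭, t ≫ ((act.baseChange g).baseChange s₁).i x = 1) ↔ ∃ s' : T ⟶ G₁, s' ≫ ι₁ = t)
    (β₁ : O → (G₁ ⟶ G₁)) (hβ₁ : ∀ x, β₁ x ≫ ι₁ = ι₁ ≫ ((act.baseChange g).baseChange s₁).i x)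
    (ι₂ : G₂ ⟶ ((A.baseChange g).baseChange s₂).X) (hι₂ : IsMonHom ι₂ ∧ IsClosedImmersion ι₂.left)
    (hker₂ : ∀ ⦃T : SchemeOver k⦄ (t : T ⟶ ((A.baseChange g).baseChange s₂).X),
      (∀ x ∈ 𝔭, t ≫ ((act.baseChange g).baseChange s₂).i x = 1) ↔ ∃ s' : T ⟶ G₂, s' ≫ ι₂ = t)
    (β₂ : O → (G₂ ⟶ G₂)) (hβ₂ : ∀ x, β₂ x ≫ ι₂ = ι₂ ≫ ((act.baseChange g).baseChange s₂).i x)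
    (hrank : Module.finrank k (Alg G₁) = Module.finrank k (Alg G₂)) :
    ∃ φ : G₁ ≅ G₂, IsMonHom φ.hom ∧ IsMonHom φ.inv ∧ (∀ x, β₁ x ≫ φ.hom = φ.hom ≫ β₂ x) ∧ (∀ x, β₂ x ≫ φ.inv = φ.inv ≫ β₁ x) := by
  obtain ⟨m, E, hE, P, Q, N, hN, hP, hQ, hQP, hPQ, hQr, hPc, u, humon, huiso, hu⟩ := pkg
  haveI := humon
  haveI := huiso
  exact exists_layerIso_of_reducedRecognition g s₁ s₂ act E hE P Q hN hP hQ hQP hPQ hQr hPc 𝔭 u hu ι₁ hι₁ hker₁ β₁ hβ₁ ι₂ hι₂ hker₂ β₂ hβ₂ hrank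

set_option maxHeartbeats 400000 in
/-- **PACKAGED FORM, RANKS READ BEFORE THE GROUP STRUCTURES (ED. 3)** — as `exists_layerIso_of_reducedRecognition_pkg`, but the two rank equations `rank_k Γ(Gᵢ) = r`
(`0 < r`) are binders placed BEFORE the group-object ∕ affineness instances of the pins, so that their `Module k (Alg Gᵢ)` instance is the bare algebra structure (the
shape of the dock row `hrkG₀`, which is typed before `grp₀` is an instance), and `Module.Finite` is derived here (`0 < r`); this is the form the moduli tower can
instantiate by pure unification. [cite: Conrad2004GrossZagier, §7 (Thm. 7.5)] [cite: Tate1997FiniteFlatGroupSchemes, (3.7)] -/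
theorem exists_layerIso_of_reducedRecognition_of_rank (𝔭 : Ideal O) [𝔭.IsMaximal]
    (pkg : ∃ (m : ℕ) (E : Matrix (Fin m) (Fin m) O) (hE : E * E = E) (P : Matrix (Fin m) (Fin 1) O) (Q : Matrix (Fin 1) (Fin m) O) (N : ℕ),
        N ≠ 0 ∧ E * P = P ∧ Q * E = Q ∧ Q * P = Matrix.scalar (Fin 1) (N : O) ∧ P * Q = Matrix.scalar (Fin m) (N : O) * E ∧
        (∀ j k', Q j k' ∈ Set.range fun k' => Q 0 k') ∧
        (∀ c ∈ Set.range (fun k' => Q 0 k'), ∃ Pc : Matrix (Fin m) (Fin 1) O, E * Pc = Pc ∧ Pc * Q = c • E) ∧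
        ∃ (u : (((serreTensor act E hE).baseChange g).baseChange s₁).X ⟶ ((A.baseChange g).baseChange s₂).X) (_ : IsMonHom u) (_ : IsIso u),
          ∀ a, (((serreAction act E hE).baseChange g).baseChange s₁).i a ≫ u = u ≫ ((act.baseChange g).baseChange s₂).i a)
    {G₁ G₂ : SchemeOver k} {r : ℕ} (hrk₁ : Module.finrank k (Alg G₁) = r) (hrk₂ : Module.finrank k (Alg G₂) = r) (hr : 0 < r)
    [GrpObj G₁] [GrpObj G₂] [IsAffine G₁.left] [IsAffine G₂.left] [IsFinite G₁.hom] [IsFinite G₂.hom]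
    (ι₁ : G₁ ⟶ ((A.baseChange g).baseChange s₁).X) (hι₁ : IsMonHom ι₁ ∧ IsClosedImmersion ι₁.left)
    (hker₁ : ∀ ⦃T : SchemeOver k⦄ (t : T ⟶ ((A.baseChange g).baseChange s₁).X),
      (∀ x ∈ 𝔭, t ≫ ((act.baseChange g).baseChange s₁).i x = 1) ↔ ∃ s' : T ⟶ G₁, s' ≫ ι₁ = t)
    (β₁ : O → (G₁ ⟶ G₁)) (hβ₁ : ∀ x, β₁ x ≫ ι₁ = ι₁ ≫ ((act.baseChange g).baseChange s₁).i x)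
    (ι₂ : G₂ ⟶ ((A.baseChange g).baseChange s₂).X) (hι₂ : IsMonHom ι₂ ∧ IsClosedImmersion ι₂.left)
    (hker₂ : ∀ ⦃T : SchemeOver k⦄ (t : T ⟶ ((A.baseChange g).baseChange s₂).X),
      (∀ x ∈ 𝔭, t ≫ ((act.baseChange g).baseChange s₂).i x = 1) ↔ ∃ s' : T ⟶ G₂, s' ≫ ι₂ = t)
    (β₂ : O → (G₂ ⟶ G₂)) (hβ₂ : ∀ x, β₂ x ≫ ι₂ = ι₂ ≫ ((act.baseChange g).baseChange s₂).i x) :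
    ∃ φ : G₁ ≅ G₂, IsMonHom φ.hom ∧ IsMonHom φ.inv ∧ (∀ x, β₁ x ≫ φ.hom = φ.hom ≫ β₂ x) ∧ (∀ x, β₂ x ≫ φ.inv = φ.inv ≫ β₁ x) := by
  haveI : Module.Finite k (Alg G₁) := Module.finite_of_finrank_pos (by rw [hrk₁]; exact hr)
  haveI : Module.Finite k (Alg G₂) := Module.finite_of_finrank_pos (by rw [hrk₂]; exact hr)
  exact exists_layerIso_of_reducedRecognition_pkg g s₁ s₂ act 𝔭 pkg ι₁ hι₁ hker₁ β₁ hβ₁ ι₂ hι₂ hker₂ β₂ hβ₂ (hrk₁.trans hrk₂.symm)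


/-! ## §3 (ED. 4) The fibre-level form: an equivariant recognition `A₁ ⊗_𝒪 𝔟 ≅ A₂` of abelian schemes over ONE field -/

section Fibre

variable {k : Type u} [Field k] {A₁ A₂ : AbelianSchemeOver (Spec (.of k))} {O : Type*} [CommRing O] [IsDedekindDomain O] [CharZero O]
  (act₁ : A₁.RingAction O) (act₂ : A₂.RingAction O) [IsCommMonObj A₁.X]
  {m : ℕ} (E : Matrix (Fin m) (Fin m) O) (hE : E * E = E) (P : Matrix (Fin m) (Fin 1) O) (Q : Matrix (Fin 1) (Fin m) O) {N : ℕ}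

set_option maxHeartbeats 400000 in
/-- **LAYER ISO FROM A FIBRE-LEVEL RECOGNITION (ED. 4).**  `A₁, A₂` abelian schemes over a field `k` with actions of a Dedekind domain `𝒪` (`A₁` commutative as a group object),
`(E, P, Q, N)` a Serre presentation (`EP = P`, `QE = Q`, `QP = N ≠ 0`, `PQ = N•E`, the entries of `Q` in the range of its first row, a column `P_c` for every such entry),
`𝔭` maximal, `u : A₁ ⊗_𝒪 𝔟 ⥲ A₂` an ISOMORPHISM of group schemes intertwining the Serre action on `A₁ ⊗_𝒪 𝔟 = serreTensor act₁ E` and `act₂`, and PINS `ι₁ : G₁ ↪ A₁`,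
`ι₂ : G₂ ↪ A₂` of the `𝔭`-layers (homomorphic closed immersions with the kernel-of-`𝔭` universal property, affine, finite, coordinate algebras finite of EQUAL rank, actions
`β₁, β₂` over `act₁, act₂`).  THEN `G₁ ≅ G₂`, homomorphically both ways and equivariantly.  (The §2 head with every base change deleted: the cover `ψ′_Q : A₁ ⊗ 𝔟 → A₁`, the
return map `ψ_{P_{c₀}}` for the generator `c₀ ∉ 𝔞′𝔭` of §1, ★ (R8) `exists_layerIso_of_serreCover_of_iso` with the source pinned through `u`.)
[cite: Conrad2004GrossZagier, §7 (Thm. 7.5)] [cite: MumfordAV1970, §7 Thm. 4 (p. 72)] [cite: Tate1997FiniteFlatGroupSchemes, (3.7)] -/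
theorem exists_layerIso_of_fibreRecognition
    (hN : N ≠ 0) (hP : E * P = P) (hQ : Q * E = Q)
    (hQP : Q * P = Matrix.scalar (Fin 1) (N : O)) (hPQ : P * Q = Matrix.scalar (Fin m) (N : O) * E)
    (hQr : ∀ j k', Q j k' ∈ Set.range fun k' => Q 0 k')
    (hPc : ∀ c ∈ Set.range (fun k' => Q 0 k'), ∃ Pc : Matrix (Fin m) (Fin 1) O, E * Pc = Pc ∧ Pc * Q = c • E)
    (𝔭 : Ideal O) [𝔭.IsMaximal]
    (u : (serreTensor act₁ E hE).X ⟶ A₂.X) [IsMonHom u] [IsIso u]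
    (hu : ∀ a, (serreAction act₁ E hE).i a ≫ u = u ≫ act₂.i a)
    {G₁ G₂ : SchemeOver k} [GrpObj G₁] [GrpObj G₂] [IsAffine G₁.left] [IsAffine G₂.left]
    [Module.Finite k (Alg G₁)] [Module.Finite k (Alg G₂)] [IsFinite G₁.hom] [IsFinite G₂.hom]
    (ι₁ : G₁ ⟶ A₁.X) (hι₁ : IsMonHom ι₁ ∧ IsClosedImmersion ι₁.left)
    (hker₁ : ∀ ⦃T : SchemeOver k⦄ (t : T ⟶ A₁.X), (∀ x ∈ 𝔭, t ≫ act₁.i x = 1) ↔ ∃ s' : T ⟶ G₁, s' ≫ ι₁ = t)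
    (β₁ : O → (G₁ ⟶ G₁)) (hβ₁ : ∀ x, β₁ x ≫ ι₁ = ι₁ ≫ act₁.i x)
    (ι₂ : G₂ ⟶ A₂.X) (hι₂ : IsMonHom ι₂ ∧ IsClosedImmersion ι₂.left)
    (hker₂ : ∀ ⦃T : SchemeOver k⦄ (t : T ⟶ A₂.X), (∀ x ∈ 𝔭, t ≫ act₂.i x = 1) ↔ ∃ s' : T ⟶ G₂, s' ≫ ι₂ = t)
    (β₂ : O → (G₂ ⟶ G₂)) (hβ₂ : ∀ x, β₂ x ≫ ι₂ = ι₂ ≫ act₂.i x)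
    (hrank : Module.finrank k (Alg G₁) = Module.finrank k (Alg G₂)) :
    ∃ φ : G₁ ≅ G₂, IsMonHom φ.hom ∧ IsMonHom φ.inv ∧ (∀ x, β₁ x ≫ φ.hom = φ.hom ≫ β₂ x) ∧ (∀ x, β₂ x ≫ φ.inv = φ.inv ≫ β₁ x) := by
  -- (1) the generator `c₀` of `𝔞′ = (Q)` outside `𝔞′𝔭` and its cofactor
  have hspanQ : Ideal.span (Set.range fun k' => Q 0 k') ≠ ⊥ := by
    intro h0
    have hQ0 : ∀ k', Q 0 k' = 0 := fun k' => by
      have : Q 0 k' ∈ Ideal.span (Set.range fun k' => Q 0 k') := Ideal.subset_span ⟨k', rfl⟩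
      rw [h0] at this
      exact (Submodule.mem_bot _).mp this
    have hQP0 : (Q * P) 0 0 = 0 := by
      rw [Matrix.mul_apply]
      exact Finset.sum_eq_zero fun k' _ => by rw [hQ0 k', zero_mul]
    rw [hQP, Matrix.scalar_apply, Matrix.diagonal_apply_eq] at hQP0
    exact hN (Nat.cast_eq_zero.mp hQP0)
  obtain ⟨c₀, hc₀, r, r', hr, hrr'⟩ := Ideal.exists_generator_cofactor (Set.range fun k' => Q 0 k') hspanQ 𝔭
  obtain ⟨Pc, hPc1, hPc2⟩ := hPc c₀ hc₀
  -- (2) the cover `ψ := ψ′_Q : A₁ ⊗ 𝔟 → A₁` and the return map `ψ′ := ψ_{Pc} : A₁ → A₁ ⊗ 𝔟` (no base change)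
  haveI := isMonHom_serreTranslateInv act₁ E hE Q
  haveI := isMonHom_serreTranslate act₁ E hE Pc
  haveI := flat_serreTranslateInv_left act₁ E hE Q P hN hP hQ hQP hPQ
  haveI := surjective_serreTranslateInv_left act₁ E hE Q P hN hP hQ hQP hPQ
  haveI := isFinite_serreTranslateInv_left act₁ E hE Q P hN hP hQ hQP hPQ
  have hψψ' : serreTranslateInv act₁ E hE Q ≫ serreTranslate act₁ E hE Pc = (serreAction act₁ E hE).i c₀ :=
    serreTranslateInv_comp_serreTranslate_of_mul_eq_smul act₁ E hE Q hQ Pc hPc1 hPc2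
  have hkerψ : ∀ ⦃T : SchemeOver k⦄ (t : T ⟶ (serreTensor act₁ E hE).X),
      (∀ a' ∈ Ideal.span (Set.range fun k' => Q 0 k'), t ≫ (serreAction act₁ E hE).i a' = 1) → t ≫ serreTranslateInv act₁ E hE Q = 1 :=
    fun T t ht => (comp_serreTranslateInv_eq_one_iff_forall_comp_serreAction_i_eq_one act₁ E hE Q hQ (Set.range fun k' => Q 0 k') hQr hPc t).mpr
      fun a' ha' => ht a' (Ideal.subset_span ha')
  -- (3) ★ (R8) ED. 2, source pinned through `u`
  obtain ⟨φ, -, hmon, hmon', hβ, hβ'⟩ :=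
    exists_layerIso_of_serreCover_of_iso (k := k) 𝔭 (Ideal.span (Set.range fun k' => Q 0 k'))
      (fun a => (serreAction act₁ E hE).i a) (fun a => act₁.i a) (fun a => act₂.i a)
      (fun a => RingAction.isMonHom _ a) (fun a => RingAction.isMonHom _ a)
      (fun a b => RingAction.i_mul _ a b)
      (fun a b => RingAction.i_mul _ a b) (fun a b => RingAction.i_add _ a b) (RingAction.i_one _)
      u hu ι₂ hι₂ hker₂ β₂ hβ₂ ι₁ hι₁ hker₁ β₁ hβ₁ hrank
      (serreTranslateInv act₁ E hE Q) (fun a => i_comp_serreTranslateInv act₁ E hE Q hQ a) hkerψ hr hrr'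
      (serreTranslate act₁ E hE Pc) (fun a => i_comp_serreTranslate act₁ E hE Pc hPc1 a) hψψ'
  exact ⟨φ, hmon, hmon', hβ, hβ'⟩

set_option maxHeartbeats 400000 in
/-- **FIBRE-LEVEL FORM, PACKAGED, RANKS READ BEFORE THE GROUP STRUCTURES (ED. 4)** — as `exists_layerIso_of_fibreRecognition` with the presentation and the recognition as ONE
∃-package and the rank rows `rank_k Γ(Gᵢ) = r` (`0 < r`) as binders placed BEFORE the group-object ∕ affineness instances (the dock shape; `Module.Finite` derived here).
[cite: Conrad2004GrossZagier, §7 (Thm. 7.5)] [cite: Tate1997FiniteFlatGroupSchemes, (3.7)] -/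
theorem exists_layerIso_of_fibreRecognition_of_rank (𝔭 : Ideal O) [𝔭.IsMaximal]
    (pkg : ∃ (m : ℕ) (E : Matrix (Fin m) (Fin m) O) (hE : E * E = E) (P : Matrix (Fin m) (Fin 1) O) (Q : Matrix (Fin 1) (Fin m) O) (N : ℕ),
        N ≠ 0 ∧ E * P = P ∧ Q * E = Q ∧ Q * P = Matrix.scalar (Fin 1) (N : O) ∧ P * Q = Matrix.scalar (Fin m) (N : O) * E ∧
        (∀ j k', Q j k' ∈ Set.range fun k' => Q 0 k') ∧
        (∀ c ∈ Set.range (fun k' => Q 0 k'), ∃ Pc : Matrix (Fin m) (Fin 1) O, E * Pc = Pc ∧ Pc * Q = c • E) ∧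
        ∃ (u : (serreTensor act₁ E hE).X ⟶ A₂.X) (_ : IsMonHom u) (_ : IsIso u), ∀ a, (serreAction act₁ E hE).i a ≫ u = u ≫ act₂.i a)
    {G₁ G₂ : SchemeOver k} {r : ℕ} (hrk₁ : Module.finrank k (Alg G₁) = r) (hrk₂ : Module.finrank k (Alg G₂) = r) (hr : 0 < r)
    [GrpObj G₁] [GrpObj G₂] [IsAffine G₁.left] [IsAffine G₂.left] [IsFinite G₁.hom] [IsFinite G₂.hom]
    (ι₁ : G₁ ⟶ A₁.X) (hι₁ : IsMonHom ι₁ ∧ IsClosedImmersion ι₁.left)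
    (hker₁ : ∀ ⦃T : SchemeOver k⦄ (t : T ⟶ A₁.X), (∀ x ∈ 𝔭, t ≫ act₁.i x = 1) ↔ ∃ s' : T ⟶ G₁, s' ≫ ι₁ = t)
    (β₁ : O → (G₁ ⟶ G₁)) (hβ₁ : ∀ x, β₁ x ≫ ι₁ = ι₁ ≫ act₁.i x)
    (ι₂ : G₂ ⟶ A₂.X) (hι₂ : IsMonHom ι₂ ∧ IsClosedImmersion ι₂.left)
    (hker₂ : ∀ ⦃T : SchemeOver k⦄ (t : T ⟶ A₂.X), (∀ x ∈ 𝔭, t ≫ act₂.i x = 1) ↔ ∃ s' : T ⟶ G₂, s' ≫ ι₂ = t)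
    (β₂ : O → (G₂ ⟶ G₂)) (hβ₂ : ∀ x, β₂ x ≫ ι₂ = ι₂ ≫ act₂.i x) :
    ∃ φ : G₁ ≅ G₂, IsMonHom φ.hom ∧ IsMonHom φ.inv ∧ (∀ x, β₁ x ≫ φ.hom = φ.hom ≫ β₂ x) ∧ (∀ x, β₂ x ≫ φ.inv = φ.inv ≫ β₁ x) := by
  haveI : Module.Finite k (Alg G₁) := Module.finite_of_finrank_pos (by rw [hrk₁]; exact hr)
  haveI : Module.Finite k (Alg G₂) := Module.finite_of_finrank_pos (by rw [hrk₂]; exact hr)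
  obtain ⟨m, E, hE, P, Q, N, hN, hP, hQ, hQP, hPQ, hQr, hPc, u, humon, huiso, hu⟩ := pkg
  haveI := humon
  haveI := huiso
  exact exists_layerIso_of_fibreRecognition act₁ act₂ E hE P Q hN hP hQ hQP hPQ hQr hPc 𝔭 u hu ι₁ hι₁ hker₁ β₁ hβ₁ ι₂ hι₂ hker₂ β₂ hβ₂
    (hrk₁.trans hrk₂.symm)

end Fibre

end AbelianSchemeOver

end Literature.AlgebraicGeometry.AbelianSchemes

end
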